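import Literature.AlgebraicGeometry.Surfaces.K3ComplexMultiplication
import Literature.AlgebraicGeometry.Motives.MotivatedPeriodTorsor
import Literature.AlgebraicGeometry.HodgeTheory.HodgeConjecture
import HarnessLib

/-!
# Ramón Marí 2008, Prop. 3.1 in the case of a CM endomorphism field (= Varesco 2025, Thm. 2.2 / §2.3): for a projective K3 surface with complex multiplication, the Hodge conjecture for all powers `Xⁿ` follows from the Hodge conjecture for `X × X` — NAMED FACT; with Buskin 2019 / Huybrechts 2019 (CM squares) the Hodge conjecture for all powers of K3 surfaces with complex multiplication (Ramón Marí 2008 Thm. 3.3 = Varesco 2025 Cor. 2.3) — DERIVED. ERRATUM [v2]: the v1 record WITHOUT the CM hypothesis is not a theorem in print (Varesco 2025, Thm. 2.16 and Rem. 2.17) and is kept below only until its summit-side user is migrated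

Layer `Literature/AlgebraicGeometry/Surfaces`.  CITE record for the Hodge-ladder stage-4 scoping
(run/shared/lean/pub/hodge-director/STAGE4-ABELIAN-MOTIVIC-TYPE.md v4/v8, row 1 "K3 surfaces: products and
powers"): for K3 surfaces WITH COMPLEX MULTIPLICATION the summit-side targets `HC_K3Pairs` (products
`S × S'`) and `HC_K3Powers` (powers `Sᵐ`) are linked in print — powers reduce to the SQUARE — and the CM
entry of row 1 (`Surfaces.Buskin2019_hodgeConjectureFor_square_of_CM`, Huybrechts 2019 Cor. 0.4 (ii): the
square `S × S`) thereby extends to ALL powers, which is Ramón Marí's Thm. 3.3 (= Varesco 2025 Cor. 2.3).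

## ERRATUM [v2, 2026-08-21, literature seat hodge-director-lit-stage4 gen 8]

v1 of this file (p246403) recorded Ramón Marí's Prop. 3.1 AS PRINTED, i.e. for EVERY complex projective
K3 surface: "The Hodge conjecture for `Xⁿ`, for arbitrary `n`, holds if it holds for `X × X`"
(`RamonMari2008_hodgeClasses_algebraic_K3Powers_of_square`, v1 record REMOVED in v3, 2026-08-21, once its summit-side users were migrated).  The
printed proof ("it is known (see [Zarhin]) that `Hg(X)_ℂ` is isomorphic to a product of special orthogonal
or general linear groups, which shows (see [Ribet]) that the ring of tensor invariants of `Hg(X)` is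
generated by the degree-`2` invariants") is refuted in print for a TOTALLY REAL endomorphism field
`E = End_{Hdg}(T(X))`: M. Varesco, *The Hodge conjecture for powers of K3 surfaces of Picard number 16*,
Michigan Math. J. 75 (2025), no. 5 [Varesco2025] (read: arXiv text `paper:arxiv-2203.09778`, §2, arXiv
numbering).  §2, opening: "A similar study has been done in [Ramón Marí 2008]. However, there is a mistake
in the proof of [Ramón Marí 2008] that leads to a wrong conclusion in the case of K3 surfaces with totally
real multiplication."  **Theorem 2.2** ([Ramón Marí 2008]): "Let `X` be a K3 surface whose endomorphism
field is a CM field. Then, any Hodge class `⨂^• T(X)` can be expressed in terms of Hodge classes in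
`T(X)^{⊗2}`."  "Note that in the reference it is stated that the same holds also in the case of K3
surfaces with totally real multiplication. In the next section, we show that this is not true."
**Corollary 2.3** ([Ramón Marí 2008]): "Let `X` be a complex, projective K3 surface whose endomorphism
field is a CM field. Then the Hodge conjecture holds for all powers of `X`." (Printed proof: Thm. 2.2 +
"This has been proved in [Buskin 2019] and again in [Huybrechts 2019], where the authors prove the Hodge
conjecture for the square of a K3 surface with CM endomorphism field.")  **Theorem 2.14** ([Kraft–Procesi]):
"the `SO(V_σ,ℂ)`-invariants in `⨂^• V_σ` can be expressed in terms of `SO(V_σ,ℂ)`-invariants of degree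
two and `det V_σ`."  **Theorem 2.16**: "Let `X` be a K3 surface with a totally real endomorphism field
`E`. Then, any Hodge class in `⨂^• T(X)` can be expressed in terms of Hodge classes of degree two and
the exceptional Hodge classes" (the exceptional classes: the subspace `⋀ʳ_E T(X) ⊂ T(X)^{⊗r}`,
`r = dim_E T(X)`, "consists of Hodge classes").  **Remark 2.17**: "The mistake in the proof of [Ramón Marí
2008] in the case of K3 surfaces with totally real multiplication is the wrong assumption that any
invariant under the action of the special orthogonal group can be expressed in terms of invariants of
degree two.  Therefore, if the endomorphism field of the K3 surface is totally real, there are `|E:ℚ|`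
Hodge classes of degree `2 dim_E T(X)` which cannot be expressed in terms of Hodge classes in
`T(X)^{⊗2}`. Thus, in this case, it is not true that the Hodge conjecture for the second power of the K3
surface implies the Hodge conjecture for all the powers."  §2.3: "in the case of CM endomorphism field,
the Hodge conjecture for `X²` implies the Hodge conjecture for all powers of `X`."

Consequences for this file.  (1) The v2 record `RamonMari2008_hodgeClasses_algebraic_K3Powers_of_square_of_CM`
below carries the CM hypothesis (`HasComplexMultiplication S`, file `K3ComplexMultiplication`: "`E` is a
CM field"); its printed proofs are Ramón Marí 2008 Prop. 3.1 (the `GL` branch of the argument) and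
Varesco 2025 Thm. 2.2 / §2.3.  (2) The derived theorem "all powers of a CM K3 surface" is re-derived from
the v2 record and the CM-square record — unchanged in content (Ramón Marí Thm. 3.3 = Varesco Cor. 2.3).
(3) The v1 record is NOT a theorem in print when `E` is totally real: there the implication "square ⟹ all
powers" is, by Thm. 2.16, equivalent (given the square) to the algebraicity of one exceptional class on
`X^r`, which Varesco proves only for the Picard-16 families of his Thm. 4.3 (via an algebraic Kuga–Satake
correspondence) — it is retained at the end of this file with its statement byte-identical solely because
`Summits/HodgeConjecture/CorCM/Stage4RowOnePowersOfSquare.lean` (p246533) still names it, and is to be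
DELETED by v3 of this file once that user is migrated to the v2 record (net Literature debt of the
v2 → v3 sequence: 0).  Nothing in the tree used the v1 record outside that file.

## Source (read: arXiv text `paper:arxiv-math_0505357`)

J. J. Ramón Marí, *On the Hodge conjecture for products of certain surfaces*, Collect. Math. 59 (2008),
no. 1, 1–26 [RamonMari2008].  §0: "Unless otherwise stated, we use the terms curve and surface to denote
smooth projective curves and surfaces, resp. […] We define the (rational) transcendental lattice `T(S)`
of a surface `S` by the following orthogonal decomposition `H²(S) = T(S) ⊕ NS(S)_ℚ` with respect to the
cup-product."  §3: "Let `X` be a K3 surface, and let `𝓗^•(X) ⊂ H^•(X)` be the ring of Hodge classes of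
`X`. […] if `E = End_hg T(X)` we have an inclusion `E ↪ End_ℂ(H^{2,0}(X)) = ℂ` which renders `E` a number
field. It can be shown that `E` is either totally real or CM [Zarhin]."  **Proposition 3.1.** "The Hodge
conjecture for `Xⁿ`, for arbitrary `n`, holds if it holds for `X × X`."  (Proof printed: "The ring of
Hodge classes `𝓗^•(Xⁿ)` is […] generated by the Hodge classes in the tensor powers of `T(X)` up to order
`n` and by pullbacks of algebraic classes on `X` via the canonical projections. Thus our result amounts to
show that the ring of tensor invariants of the `Hg(X)`-module `T(X)` is generated by those of degree `2` as
an algebra; it is known (see [Zarhin]) that `Hg(X)_ℂ` is isomorphic to a product of special orthogonal or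
general linear groups, which shows (see [Ribet]) that the ring of tensor invariants of `Hg(X)` is generated
by the degree-`2` invariants" — valid for the general linear factors, i.e. for `E` a CM field (Varesco
2025 Thm. 2.2, proof via the first fundamental theorem for `GL(V^{1,0})`), invalid for the special
orthogonal factors (Varesco 2025 Thm. 2.14 / Rem. 2.17).)  **Lemma 3.2.** "Let `E` be a CM number field.
Then `E` is spanned as a vector space over `ℚ` by elements `γ_i ∈ E` such that `γ_i γ̄_i = 1`."
**Theorem 3.3.** "Let `X` be a K3 surface such that `E = End_hg T(X)` is a CM field. Then the Hodge
conjecture holds for arbitrary powers of `X`."  (Printed proof: Lemma 3.2 + "Theorem 3.4 [Mukai]: Let `X₁`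
and `X₂` be K3 surfaces, and let `ψ : T(X₁) → T(X₂)` be a Hodge isometry. Then `ψ` is induced by an
algebraic cycle" — the statement established for all Picard ranks in Buskin, J. reine angew. Math. 755
(2019), Thm. 1.1, the tree's record `Surfaces.Buskin2019_hodgeIsometry_algebraic`.)

## Rendering and faithfulness

* "K3 surface" (projective, §0 convention): the tree's `IsK3Surface S` (file `K3Surface`); `X × X` is the
  fibre product `S ⊗ S` (a smooth projective fourfold, `IsK3Surface.isSmoothProjective_tensor_self`); the
  powers `Xⁿ` are the cartesian powers `S.pow (m + 1)` (`Motives.SchemeOver.pow`, dimension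
  `(m + 1) * 2`; `X¹ = Spec ℂ ⊗ X ≅ X`).
* "`E = End_hg T(X)` is a CM field" / "endomorphism field is a CM field": the tree's
  `HasComplexMultiplication S` (file `K3ComplexMultiplication`, Huybrechts 2019 Cor. 0.4 (ii) / Zarhin:
  equivalent formulation "some rational Hodge endomorphism acts on `H^{2,0}` by a non-real scalar", see
  that file's docstring).
* ONE named fact of record (the v2 def).  Theorem 3.3 / Cor. 2.3 is NOT a second fact: it is DERIVED below
  from the v2 record and the tree's record of the CM square (`Buskin2019_hodgeConjectureFor_square_of_CM` =
  Buskin's Corollary / Huybrechts 2019 Cor. 0.4 (ii)), which is how both printed proofs run.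

## What is NOT here

Ramón Marí's Thm. 2.14 (products of surfaces with `p_g = 1`, `q = 2`); the invariant theory of `Hg(X)`
(Zarhin, Ribet, Kraft–Procesi); Varesco's exceptional classes `⋀ʳ_E T(X)` (no `E`-structure on the real
carriers), his Thm. 2.16, Prop. 2.22 (algebraicity of `det T(X)` is closed in families) and Thm. 4.3
(Picard number 16); any proof of the records.
-/

noncomputable section

open CategoryTheory MonoidalCategory

namespace Literature.AlgebraicGeometry.Surfaces

/-- **Ramón Marí 2008 Prop. 3.1, case of a CM endomorphism field (Varesco 2025 Thm. 2.2 / §2.3): for a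
complex projective K3 surface with complex multiplication, algebraicity of the Hodge classes on `X × X`
implies algebraicity of the Hodge classes on every power `Xⁿ`** (printed sentences in the module
docstring: Ramón Marí "[the statement] for `Xⁿ`, for arbitrary `n`, holds if it holds for `X × X`", whose
printed proof is valid exactly on the general-linear (CM) branch; Varesco §2.3 "in the case of CM
endomorphism field, [the statement] for `X²` implies [the statement] for all powers of `X`").  Rendering:
for `S` with `IsK3Surface S` and `HasComplexMultiplication S`, the tree's per-variety Hodge statement for
the fibre square `S ⊗ S` in dimension `4` implies the same statement for every cartesian power
`S.pow (m + 1)` in dimension `(m + 1) * 2`.  A THEOREM in print (status: proved — first fundamental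
theorem of invariant theory for the general linear group applied to `Hg(T(X))_ℂ ≅ ∏_σ GL`; unproved in
the tree). [cite: RamonMari2008, Prop. 3.1 (§3), case `E` CM] [cite: Varesco2025, Thm. 2.2, Cor. 2.3 and §2.3 (arXiv:2203.09778 numbering)] -/
def RamonMari2008_hodgeClasses_algebraic_K3Powers_of_square_of_CM : Prop :=
  ∀ ⦃S : Motives.SchemeOver ℂ⦄, IsK3Surface S → HasComplexMultiplication S →
    HodgeTheory.HodgeConjectureFor 4 (S ⊗ S) →
    ∀ m : ℕ, HodgeTheory.HodgeConjectureFor ((m + 1) * 2) (S.pow (m + 1))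

namespace RamonMari2008_hodgeClasses_algebraic_K3Powers_of_square_of_CM

variable {S : Motives.SchemeOver ℂ}

/-- Application form of Prop. 3.1 (CM case). [cite: RamonMari2008, Prop. 3.1] [cite: Varesco2025, Thm. 2.2 and §2.3] -/
theorem hodgeConjectureFor_pow (h : RamonMari2008_hodgeClasses_algebraic_K3Powers_of_square_of_CM)
    (hS : IsK3Surface S) (hCM : HasComplexMultiplication S)
    (hsq : HodgeTheory.HodgeConjectureFor 4 (S ⊗ S)) (m : ℕ) :
    HodgeTheory.HodgeConjectureFor ((m + 1) * 2) (S.pow (m + 1)) :=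
  h hS hCM hsq m

/-- **Ramón Marí 2008, Thm. 3.3 = Varesco 2025, Cor. 2.3 (derived, as both printed proofs run): the Hodge
conjecture holds for arbitrary powers of a complex projective K3 surface with complex multiplication** —
"Let `X` be a K3 surface such that `E = End_hg T(X)` is a CM field. Then the Hodge conjecture holds for
arbitrary powers of `X`": here from the CM-case Prop. 3.1 (this file's record) and the CM square
(`Buskin2019_hodgeConjectureFor_square_of_CM`, Buskin 2019 Corollary / Huybrechts 2019 Cor. 0.4 (ii)).
[cite: RamonMari2008, Thm. 3.3 and Prop. 3.1] [cite: Varesco2025, Cor. 2.3] [cite: Huybrechts2019, Cor. 0.4 (ii)]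
[cite: Buskin2019, Thm. 1.1 and Corollary] -/
theorem hodgeConjectureFor_pow_of_CM (h : RamonMari2008_hodgeClasses_algebraic_K3Powers_of_square_of_CM)
    (hB : Buskin2019_hodgeConjectureFor_square_of_CM) (hS : IsK3Surface S) (hCM : HasComplexMultiplication S)
    (m : ℕ) : HodgeTheory.HodgeConjectureFor ((m + 1) * 2) (S.pow (m + 1)) :=
  h hS hCM (hB S hS hCM) m

end RamonMari2008_hodgeClasses_algebraic_K3Powers_of_square_of_CM

end Literature.AlgebraicGeometry.Surfaces

end
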